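import Literature.Topology.FourManifolds.InfiniteCyclicCover
import Literature.Topology.FourManifolds.TorusCoordinates
import Mathlib.Analysis.Convex.Contractible
import Mathlib.AlgebraicTopology.FundamentalGroupoid.SimplyConnected
import Mathlib.Topology.Order.IntermediateValue
import HarnessLib

/-!
# A circle map homotopic to a map of nonzero degree is onto

Topic `Literature/Topology/FourManifolds`. An elementary consequence of the winding-number
calculus of `CircleMapWinding.lean` / `InfiniteCyclicCover.lean` (A. Hatcher, *Algebraic
Topology* (2002), §1.1, Thm. 1.7 and Prop. 1.30), in the concrete form used by the refutation of
the mis-stated slide lemma `FramedLink.IsStrictHandleSlide.slideDiffeoAligned`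
(`KirbyMovesSlideAlignRefutation.lean`):

* `CircleMaps.incr_eq_zero_of_forall_ne` — a circle-valued path with equal end values which
  **misses one point** of the circle has angle increment `0` (its real lift stays in one
  fundamental interval: intermediate value theorem);
* `CircleMaps.incr_bottom_eq_incr_top` — for a continuous `H : ℝ² → S¹` with `H (0, s) = H (1, s)`
  the increments along the bottom and the top side of the unit square agree (the boundary loop of
  the square is null-homotopic in the contractible plane, and the two vertical sides cancel);
* `exists_apply_eq_of_apply_zero_eq_circlePoint` — **a loop of loops starting at a loop of degree
  `n ≠ 0` stays onto**: if `A : ℝ × ℝ → 𝕊¹` is continuous, `A (0, s) = A (1, s)`, and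
  `A (t, 0) = circlePoint (2πn t)` with `n ≠ 0`, then every point of `𝕊¹` is a value `A (t, 1)`,
  `t ∈ [0, 1]`.

Everything is proved; no definitions, no named facts.

## References

* A. Hatcher, *Algebraic Topology*, CUP (2002), §1.1 Thm. 1.7, Prop. 1.30 (lifting, degree).
  [cite: HatcherAT2002, §1.1 Thm. 1.7]
-/

noncomputable section

open Set Function
open scoped unitInterval Real Topology

namespace Literature.Topology.FourManifolds

/-- Local notation: `𝔼 n` is the model Euclidean space `EuclideanSpace ℝ (Fin n)`. -/
local notation "𝔼 " n:arg => EuclideanSpace ℝ (Fin n)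

/-- Local notation: `𝕊 n` is the unit sphere in `EuclideanSpace ℝ (Fin (n + 1))`. -/
local notation "𝕊 " n:arg => (Metric.sphere (0 : EuclideanSpace ℝ (Fin (n + 1))) 1)

namespace CircleMaps

variable {X : Type*} [TopologicalSpace X]

/-! ### Paths missing a point have no winding -/

/-- **A circle-valued path with equal end values which misses a point has increment zero.**
If `f (γ t) ≠ w` for all `t` and `f (γ 0) = f (γ 1)`, then `incr f γ = 0`: dividing by `w`, the
real lift of the path misses `2πℤ`, so by the intermediate value theorem it cannot move from one
point of `θ₀ + 2πℤ` to another. Hatcher (2002), §1.1. [folklore] -/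
theorem incr_eq_zero_of_forall_ne (f : C(X, Circle)) {x y : X} (γ : Path x y) (w : Circle)
    (hne : ∀ t, f (γ t) ≠ w) (hend : f x = f y) : incr f γ = 0 := by
  -- reduce to `w = 1`
  set g : C(X, Circle) := f * ContinuousMap.const X w⁻¹ with hg
  have hfg : f = g * ContinuousMap.const X w := by
    ext z : 1
    simp [hg]
  have hg1 : ∀ t, g (γ t) ≠ 1 := fun t h ↦ hne t (by
    have : f (γ t) * w⁻¹ = 1 := by simpa [hg] using h
    rwa [mul_inv_eq_one] at this)
  have hgend : g x = g y := by simp [hg, hend]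
  rw [hfg, incr_mul, incr_const, add_zero]
  -- the lift of `g ∘ γ` misses `2πℤ`
  set Γ := liftOf g γ with hΓ
  have hmiss : ∀ t, ∀ k : ℤ, Γ t ≠ k * (2 * π) := by
    intro t k h
    apply hg1 t
    rw [← exp_liftOf g γ t, ← hΓ, h]
    exact Circle.exp_eq_one.2 ⟨k, rfl⟩
  -- the increment is `2πm`
  have hexp : Circle.exp (Γ 1) = Circle.exp (Γ 0) := by
    rw [hΓ, exp_liftOf, exp_liftOf, γ.source, γ.target, hgend]
  obtain ⟨m, hm⟩ := Circle.exp_eq_exp.1 hexp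
  have hincr : incr g γ = m * (2 * π) := by
    change Γ 1 - Γ 0 = _
    rw [hm]; ring
  rw [hincr]
  -- and `m = 0` by the intermediate value theorem
  suffices hm0 : m = 0 by simp [hm0]
  by_contra hm0
  set k : ℤ := ⌊Γ 0 / (2 * π)⌋ with hk
  have h2π : 0 < 2 * π := by positivity
  have hk1 : (k : ℝ) * (2 * π) ≤ Γ 0 := by
    have := Int.floor_le (Γ 0 / (2 * π))
    rw [← hk] at this
    rwa [le_div_iff₀ h2π] at this
  have hk2 : Γ 0 < (k + 1 : ℝ) * (2 * π) := by
    have := Int.lt_floor_add_one (Γ 0 / (2 * π))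
    rw [← hk] at this
    rwa [div_lt_iff₀ h2π] at this
  have hk1' : (k : ℝ) * (2 * π) < Γ 0 := lt_of_le_of_ne hk1 (fun h ↦ hmiss 0 k h.symm)
  have hΓc : Continuous Γ := Γ.continuous
  rcases lt_or_gt_of_ne hm0 with hneg | hpos
  · -- `m ≤ -1`: the lift passes `2πk` on the way down
    have hm1 : (m : ℝ) ≤ -1 := by exact_mod_cast Int.le_sub_one_iff.2 hneg
    have hΓ1 : Γ 1 ≤ (k : ℝ) * (2 * π) := by rw [hm]; nlinarith
    have h01 : (0 : I) ≤ 1 := unitInterval.le_one _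
    have hsub := intermediate_value_Icc' h01 hΓc.continuousOn
    obtain ⟨t, -, ht⟩ := hsub ⟨hΓ1, hk1'.le⟩
    exact hmiss t k ht
  · -- `1 ≤ m`: the lift passes `2π(k+1)` on the way up
    have hm1 : (1 : ℝ) ≤ m := by exact_mod_cast hpos
    have hΓ1 : ((k + 1 : ℤ) : ℝ) * (2 * π) ≤ Γ 1 := by rw [hm]; push_cast; nlinarith
    have h01 : (0 : I) ≤ 1 := unitInterval.le_one _
    have hsub := intermediate_value_Icc h01 hΓc.continuousOn
    obtain ⟨t, -, ht⟩ := hsub ⟨(by push_cast; exact hk2.le), hΓ1⟩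
    exact hmiss t (k + 1) ht

/-! ### The unit square in the plane -/

/-- **Bottom and top of a square have the same increment** when the two vertical sides carry the
same circle-valued path: for `H : ℝ² → S¹` continuous with `H (0, s) = H (1, s)` (`s ∈ [0, 1]`),
`incr H bottom = incr H top` for any path `bottom` from `(0, 0)` to `(1, 0)` and any path `top`
from `(0, 1)` to `(1, 1)` (in the simply connected plane increments only depend on the end
points). The loop `bottom · right · top⁻¹ · left⁻¹` is null-homotopic in the (contractible) plane,
so its winding number vanishes (`winding_eq_of_homotopic`), and it is the sum of the four sides
(`incr_trans`, `incr_symm`), the vertical ones cancelling (`incr_congr`). Hatcher (2002), §1.1.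
[folklore] -/
theorem incr_bottom_eq_incr_top (H : C(ℝ × ℝ, Circle))
    (hper : ∀ s : I, H (0, (s : ℝ)) = H (1, (s : ℝ)))
    (bottom : Path ((0 : ℝ), (0 : ℝ)) ((1 : ℝ), (0 : ℝ)))
    (top : Path ((0 : ℝ), (1 : ℝ)) ((1 : ℝ), (1 : ℝ))) :
    incr H bottom = incr H top := by
  -- the two vertical sides
  let left : Path ((0 : ℝ), (0 : ℝ)) ((0 : ℝ), (1 : ℝ)) :=
    ⟨⟨fun s ↦ ((0 : ℝ), (s : ℝ)), by fun_prop⟩, by simp, by simp⟩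
  let right : Path ((1 : ℝ), (0 : ℝ)) ((1 : ℝ), (1 : ℝ)) :=
    ⟨⟨fun s ↦ ((1 : ℝ), (s : ℝ)), by fun_prop⟩, by simp, by simp⟩
  have hlr : incr H left = incr H right :=
    incr_congr H H left right fun s ↦ hper s
  -- the boundary loop is null-homotopic in the plane
  set loop : Path ((0 : ℝ), (0 : ℝ)) ((0 : ℝ), (0 : ℝ)) :=
    bottom.trans (right.trans (top.symm.trans left.symm)) with hloop
  have hw : winding H loop = 0 := by
    have hh : loop.Homotopic (Path.refl _) := SimplyConnectedSpace.paths_homotopic _ _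
    rw [winding_eq_of_homotopic H hh, winding_refl]
  have hincr : incr H loop = 0 := by
    rw [incr_eq_winding, hw]; simp
  rw [hloop, incr_trans, incr_trans, incr_trans, incr_symm, incr_symm] at hincr
  linarith

end CircleMaps

/-! ### Loops of loops starting at a standard loop of nonzero degree -/

/-- `toCircle : 𝕊¹ → Circle` is continuous (as in `KnotArcLift.lean`). [folklore] -/
private theorem continuous_toCircle_aux : Continuous toCircle :=
  (contDiff_toC.continuous.comp continuous_subtype_val).subtype_mk _

/-- `toCircle (cos θ, sin θ) = e^{iθ}` (as in `NonSeparatingSpheresLoopHomotopy.lean`). [folklore] -/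
private theorem toCircle_circlePoint_aux (θ : ℝ) : toCircle (circlePoint θ) = Circle.exp θ := by
  have h := toCircle_circlePt (θ / (2 * π))
  rwa [circlePt_eq_circlePoint, mul_div_cancel₀ _ (by positivity : (2 * π : ℝ) ≠ 0)] at h

/-- **A loop of loops in `𝕊¹` starting at the standard loop of degree `n ≠ 0` consists of
surjective loops.** Let `A : ℝ × ℝ → 𝕊¹` be continuous with `A (0, s) = A (1, s)` for
`s ∈ [0, 1]` (each `t ↦ A (t, s)`, `t ∈ [0, 1]`, is a loop) and `A (t, 0) = (cos 2πnt, sin 2πnt)`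
with `n ≠ 0`. Then the final loop is onto: every `z ∈ 𝕊¹` is `A (t, 1)` for some `t ∈ [0, 1]`.
Indeed the increment of `toCircle ∘ A` along the top side equals that along the bottom side
(`CircleMaps.incr_bottom_eq_incr_top`), which is `2πn ≠ 0`, whereas a loop missing `z` has
increment `0` (`CircleMaps.incr_eq_zero_of_forall_ne`). Hatcher (2002), §1.1 Thm. 1.7 (degree is
a homotopy invariant; `deg id = 1`). [cite: HatcherAT2002, §1.1 Thm. 1.7] -/
theorem exists_apply_eq_of_apply_zero_eq_circlePoint {A : ℝ × ℝ → 𝕊 1} (hA : Continuous A)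
    {n : ℤ} (hn : n ≠ 0) (h0 : ∀ t ∈ Icc (0 : ℝ) 1, A (t, 0) = circlePoint (2 * π * n * t))
    (hper : ∀ s ∈ Icc (0 : ℝ) 1, A (0, s) = A (1, s)) (z : 𝕊 1) :
    ∃ t ∈ Icc (0 : ℝ) 1, A (t, 1) = z := by
  by_contra hz
  simp only [not_exists, not_and] at hz
  set H : C(ℝ × ℝ, Circle) := ⟨fun p ↦ toCircle (A p), continuous_toCircle_aux.comp hA⟩ with hH
  let bottom : Path ((0 : ℝ), (0 : ℝ)) ((1 : ℝ), (0 : ℝ)) :=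
    ⟨⟨fun t ↦ ((t : ℝ), (0 : ℝ)), by fun_prop⟩, by simp, by simp⟩
  let top : Path ((0 : ℝ), (1 : ℝ)) ((1 : ℝ), (1 : ℝ)) :=
    ⟨⟨fun t ↦ ((t : ℝ), (1 : ℝ)), by fun_prop⟩, by simp, by simp⟩
  have hbt : CircleMaps.incr H bottom = CircleMaps.incr H top :=
    CircleMaps.incr_bottom_eq_incr_top H (fun s ↦ by
      change toCircle (A (0, s)) = toCircle (A (1, s))
      rw [hper s ⟨s.2.1, s.2.2⟩]) bottom top
  -- the bottom side has increment `2πn`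
  have hb : CircleMaps.incr H bottom = 2 * π * n := by
    rw [CircleMaps.incr_eq_of_lift H bottom (G := fun t ↦ 2 * π * n * t) (by fun_prop)
      (fun t ↦ ?_)]
    · simp
    · change Circle.exp (2 * π * n * t) = toCircle (A (t, 0))
      rw [h0 t ⟨t.2.1, t.2.2⟩, toCircle_circlePoint_aux]
  -- the top side misses `toCircle z`, so its increment vanishes
  have ht : CircleMaps.incr H top = 0 := by
    refine CircleMaps.incr_eq_zero_of_forall_ne H top (toCircle z) (fun t h ↦ ?_) ?_
    · exact hz t ⟨t.2.1, t.2.2⟩ (toCircle_injective h)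
    · change toCircle (A (0, 1)) = toCircle (A (1, 1))
      rw [hper 1 ⟨zero_le_one, le_rfl⟩]
  rw [hb, ht] at hbt
  have h2 : (2 * π : ℝ) * n = 0 := by linarith
  rcases mul_eq_zero.1 h2 with h | h
  · exact absurd h (by positivity)
  · exact hn (by exact_mod_cast h)

/-- The same, for a loop of loops starting at the **standard loop** `t ↦ (cos 2πt, sin 2πt)`
(degree `1`). [folklore] -/
theorem exists_apply_eq_of_apply_zero_eq_circlePoint_one {A : ℝ × ℝ → 𝕊 1} (hA : Continuous A)
    (h0 : ∀ t ∈ Icc (0 : ℝ) 1, A (t, 0) = circlePoint (2 * π * t))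
    (hper : ∀ s ∈ Icc (0 : ℝ) 1, A (0, s) = A (1, s)) (z : 𝕊 1) :
    ∃ t ∈ Icc (0 : ℝ) 1, A (t, 1) = z :=
  exists_apply_eq_of_apply_zero_eq_circlePoint hA one_ne_zero
    (fun t ht ↦ by rw [h0 t ht]; push_cast; ring_nf) hper z

/-- The same, for a loop of loops starting at the **reversed standard loop**
`t ↦ (cos 2πt, -sin 2πt) = reflectLast 1 (cos 2πt, sin 2πt)` (degree `-1`). [folklore] -/
theorem exists_apply_eq_of_apply_zero_eq_circlePoint_neg {A : ℝ × ℝ → 𝕊 1} (hA : Continuous A)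
    (h0 : ∀ t ∈ Icc (0 : ℝ) 1, A (t, 0) = circlePoint (-(2 * π * t)))
    (hper : ∀ s ∈ Icc (0 : ℝ) 1, A (0, s) = A (1, s)) (z : 𝕊 1) :
    ∃ t ∈ Icc (0 : ℝ) 1, A (t, 1) = z :=
  exists_apply_eq_of_apply_zero_eq_circlePoint hA (n := -1) (by norm_num)
    (fun t ht ↦ by rw [h0 t ht]; push_cast; ring_nf) hper z

end Literature.Topology.FourManifolds
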